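import Summits.QuantumFields.YangMills.Theorems.AtomicCalibrationRMassInputs
import Summits.QuantumFields.YangMills.Theorems.AtomicCalibrationRBandBridge
import Summits.QuantumFields.YangMills.Theorems.AtomicCalibrationRShellSumSupport

/-!
# AtomicCalibrationR (stmt-QuantumFields-28169), E2 `stub_offDiagonalWhitney` — the mass of one dyadic level of construction (T)
# (roadmap v2 item B.2; prover w4 g22, free hands)

For a fixed level `k+1` (cut-off `pairCut (k+1) − pairCut k`, mesh `h` with `2h ≤ 1/2`), the family of band pieces
`P_c = G · (pairCut (k+1) − pairCut k) · gridBump φ n h c`, `c : Fin n × Fin 4 → ℤ`, admits weights `M c ≥ 0` with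

* clause (v):  `‖D^m P_c (z)‖ ≤ M c / (2h)^m` for all `m ≤ N₁`, all `z`;
* clause (vi), level form:  `Summable M` and `Σ' M ≤ 2^{4n−3} · A · B`,
  `A = n² (2⌈δ/h⌉₊+1)⁴ (3/h)^{4n−4}` (`δ = 2·2^{−k} + 4h`, the count of `BandBridge.ncard_near_shell_le`),
  `B = 2^{max k' K} 4^{k'} ‖F‖_{max k' K} (1 + 2^{−k}R)^{N₁} (2^{−k})^K max(1, 2hR)^{N₁}`, `k' = 4n − 2`, `N₁ < K`, `R ≥ 2^{k+2}` a
  rate of the bump parts (`BandBump`).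

(`level_mass`.)  `M c = 0` unless the bump of cube `c` is alive somewhere, and then `distFat (centre) ≤ δ` (`MassInputs`) — which is
what makes the shell count polynomial of degree `4n − 4` and the `(1+‖centre‖)^{−(4n−2)}` decay summable (`ShellSumSupport`).
No stub/crux/rung/summit is closed; nothing here touches Yang–Mills; the YM mass gap is NOT proved. [folklore]
-/

set_option autoImplicit false

noncomputable section

open scoped BigOperators ContDiff
open Set Metric Function
open Summit.QuantumFields.YangMills.Cruxes.AtomicCalibrationR.PairCutoff (pairCut)
open Summit.QuantumFields.YangMills.Cruxes.AtomicCalibrationR.GridPartition (gridBump gridCentre)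
open Summit.QuantumFields.YangMills.Cruxes.AtomicCalibrationR.PieceUniform (norm_iteratedFDeriv_bandPiece_uniform_le)
open Summit.QuantumFields.YangMills.Cruxes.AtomicCalibrationR.MassInputs (distFat_gridCentre_le_of_alive)
open Summit.QuantumFields.YangMills.Cruxes.AtomicCalibrationR.BandBridge (ncard_near_shell_le finite_near)
open Summit.QuantumFields.YangMills.Cruxes.AtomicCalibrationR.ShellSumSupport (summable_of_shell_count_support
  tsum_le_of_shell_count_support)
open Summit.QuantumFields.YangMills.Cruxes.AtomicCalibrationR.OffDiagonalFlatness (distFat)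
open Literature.MathematicalPhysics.QuantumLattice (schwartzNorm schwartzNorm_nonneg)
open Literature.MathematicalPhysics.AQFT (IsOffDiagonal)

namespace Summit.QuantumFields.YangMills.Cruxes.AtomicCalibrationR.LevelMass

variable {n : ℕ}

/-- **Mass of one dyadic level** (clauses (v) + (vi) for the band pieces of level `k+1`).  See the module docstring. [folklore] -/
theorem level_mass (hn : 2 ≤ n) (F : SchwartzMap (Fin n → EuclideanSpace ℝ (Fin 4)) ℂ) (hF : IsOffDiagonal F)
    {G : (Fin n → EuclideanSpace ℝ (Fin 4)) → ℝ} (hG : ContDiff ℝ ∞ G)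
    (hGF : ∀ (j : ℕ) (w : Fin n → EuclideanSpace ℝ (Fin 4)), ‖iteratedFDeriv ℝ j G w‖ ≤ ‖iteratedFDeriv ℝ j F w‖)
    {φ : ℝ → ℝ} (hφ : ContDiff ℝ ∞ φ) (hφs : tsupport φ ⊆ Icc (-1 : ℝ) 1) {h : ℝ} (hh : 0 < h) (hh2 : 2 * h ≤ 1 / 2)
    (k : ℕ) {K N₁ : ℕ} (hNK : N₁ < K) {R : ℝ} (hR : (2 : ℝ) ^ (k + 2) ≤ R)
    (hb : ∀ (c : Fin n × Fin 4 → ℤ) (z : Fin n → EuclideanSpace ℝ (Fin 4)) (i : ℕ), i ≤ N₁ →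
      ‖iteratedFDeriv ℝ i (fun w => (pairCut n (k + 1) w - pairCut n k w) * gridBump φ n h c w) z‖ ≤ R ^ i) :
    ∃ M : (Fin n × Fin 4 → ℤ) → ℝ, (∀ c, 0 ≤ M c) ∧ Summable M ∧
      ∑' c, M c ≤ 2 ^ (4 * n - 4 + 1) *
        ((n : ℝ) ^ 2 * (2 * ⌈(2 * (2 : ℝ)⁻¹ ^ k + 4 * h) / h⌉₊ + 1) ^ 4 * (3 / h) ^ (4 * n - 4)) *
        (2 ^ max (4 * n - 4 + 2) K * 4 ^ (4 * n - 4 + 2) * schwartzNorm (max (4 * n - 4 + 2) K) F *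
          (1 + (2 : ℝ)⁻¹ ^ k * R) ^ N₁ * ((2 : ℝ)⁻¹ ^ k) ^ K * max 1 (2 * h * R) ^ N₁) ∧
      ∀ (c : Fin n × Fin 4 → ℤ) (m : ℕ), m ≤ N₁ → ∀ z : Fin n → EuclideanSpace ℝ (Fin 4),
        ‖iteratedFDeriv ℝ m (fun w => G w * ((pairCut n (k + 1) w - pairCut n k w) * gridBump φ n h c w)) z‖ ≤
          M c / (2 * h) ^ m := by
  classical
  -- abbreviations
  set k' : ℕ := 4 * n - 4 + 2 with hk'
  set δ : ℝ := 2 * (2 : ℝ)⁻¹ ^ k + 4 * h with hδ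
  set A : ℝ := (n : ℝ) ^ 2 * (2 * ⌈δ / h⌉₊ + 1) ^ 4 * (3 / h) ^ (4 * n - 4) with hA
  set B : ℝ := 2 ^ max k' K * 4 ^ k' * schwartzNorm (max k' K) F * (1 + (2 : ℝ)⁻¹ ^ k * R) ^ N₁ *
    ((2 : ℝ)⁻¹ ^ k) ^ K * max 1 (2 * h * R) ^ N₁ with hB
  have hS : 0 ≤ schwartzNorm (max k' K) F := schwartzNorm_nonneg _ _
  have hRpos : 0 < R := lt_of_lt_of_le (by positivity) hR
  have hA0 : 0 ≤ A := by positivity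
  have hB0 : 0 ≤ B := by positivity
  have h2h : 0 < 2 * h := by linarith
  have hh1 : h ≤ 1 := by linarith
  -- alive cubes and the weights
  let alive : (Fin n × Fin 4 → ℤ) → Prop := fun c =>
    ∃ z : Fin n → EuclideanSpace ℝ (Fin 4), (pairCut n (k + 1) z - pairCut n k z) * gridBump φ n h c z ≠ 0
  let M : (Fin n × Fin 4 → ℤ) → ℝ := fun c => if alive c then B / (1 + ‖gridCentre n h c‖) ^ k' else 0
  have hM0 : ∀ c, 0 ≤ M c := by
    intro c; simp only [M]; split_ifs
    · positivity
    · exact le_rfl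
  have hMle : ∀ c, M c ≤ B / (1 + ‖gridCentre n h c‖) ^ (4 * n - 4 + 2) := by
    intro c; simp only [M]; split_ifs
    · exact le_rfl
    · positivity
  -- support of `M` sits near the locus
  have hMsupp : ∀ c, M c ≠ 0 → distFat (gridCentre n h c) ≤ δ := by
    intro c hc
    simp only [M] at hc
    split_ifs at hc with hal
    · obtain ⟨z, hz⟩ := hal
      exact distFat_gridCentre_le_of_alive hn hφs hh hz
    · exact absurd rfl hc
  -- shell counts
  have hsubset : ∀ a : ℕ, {c : Fin n × Fin 4 → ℤ | M c ≠ 0 ∧ ⌊‖gridCentre n h c‖⌋₊ = a} ⊆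
      {c | distFat (gridCentre n h c) ≤ δ ∧ ⌊‖gridCentre n h c‖⌋₊ = a} :=
    fun a c hc => ⟨hMsupp c hc.1, hc.2⟩
  have hfinShell : ∀ a : ℕ, {c : Fin n × Fin 4 → ℤ | distFat (gridCentre n h c) ≤ δ ∧ ⌊‖gridCentre n h c‖⌋₊ = a}.Finite := by
    intro a
    refine (finite_near hn hh δ ((a : ℝ) + 1)).subset ?_
    rintro c ⟨h1, h2⟩
    refine ⟨h1, ?_⟩
    have := Nat.lt_floor_add_one (‖gridCentre n h c‖)
    rw [h2] at this
    exact_mod_cast this.le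
  have hfin : ∀ a : ℕ, {c : Fin n × Fin 4 → ℤ | M c ≠ 0 ∧ ⌊‖gridCentre n h c‖⌋₊ = a}.Finite :=
    fun a => (hfinShell a).subset (hsubset a)
  have hcount : ∀ a : ℕ, (({c : Fin n × Fin 4 → ℤ | M c ≠ 0 ∧ ⌊‖gridCentre n h c‖⌋₊ = a}.ncard : ℕ) : ℝ) ≤
      A * (2 + a) ^ (4 * n - 4) := by
    intro a
    have h1 : (({c : Fin n × Fin 4 → ℤ | M c ≠ 0 ∧ ⌊‖gridCentre n h c‖⌋₊ = a}.ncard : ℕ) : ℝ) ≤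
        ({c : Fin n × Fin 4 → ℤ | distFat (gridCentre n h c) ≤ δ ∧ ⌊‖gridCentre n h c‖⌋₊ = a}.ncard : ℕ) := by
      exact_mod_cast Set.ncard_le_ncard (hsubset a) (hfinShell a)
    exact h1.trans (ncard_near_shell_le hn hh hh1 δ a)
  refine ⟨M, hM0, ?_, ?_, ?_⟩
  · exact summable_of_shell_count_support (fun c => ‖gridCentre n h c‖) M (fun c => norm_nonneg _) hM0 hA0 hB0 hfin hcount hMle
  · have := tsum_le_of_shell_count_support (fun c => ‖gridCentre n h c‖) M (fun c => norm_nonneg _) hM0 hA0 hB0 hfin hcount hMle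
    exact this
  · -- clause (v)
    intro c m hm z
    by_cases hal : alive c
    · have hMc : M c = B / (1 + ‖gridCentre n h c‖) ^ k' := by simp only [M, if_pos hal]
      rw [hMc]
      have hmK : m < K := lt_of_le_of_lt hm hNK
      have h1 := norm_iteratedFDeriv_bandPiece_uniform_le F hF hG hGF hφ hφs hh hh2 c k (k' := k') hmK hR
        (fun z i hi => hb c z i (hi.trans hm)) z
      refine h1.trans (div_le_div_of_nonneg_right ?_ (by positivity))
      -- monotonicity in `m`
      have hr0 : 0 ≤ (2 : ℝ)⁻¹ ^ k * R := by positivity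
      have hbase1 : 1 ≤ 1 + (2 : ℝ)⁻¹ ^ k * R := by linarith
      have hpow1 : (1 + (2 : ℝ)⁻¹ ^ k * R) ^ m ≤ (1 + (2 : ℝ)⁻¹ ^ k * R) ^ N₁ := pow_le_pow_right₀ hbase1 hm
      have hpow2 : (2 * h * R) ^ m ≤ max 1 (2 * h * R) ^ N₁ :=
        (pow_le_pow_left₀ (by positivity) (le_max_right _ _) m).trans (pow_le_pow_right₀ (le_max_left _ _) hm)
      have hP0 : 0 ≤ 2 ^ max k' K * 4 ^ k' * schwartzNorm (max k' K) F / (1 + ‖gridCentre n h c‖) ^ k' := by positivity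
      calc 2 ^ max k' K * 4 ^ k' * schwartzNorm (max k' K) F / (1 + ‖gridCentre n h c‖) ^ k' *
            (1 + (2 : ℝ)⁻¹ ^ k * R) ^ m * ((2 : ℝ)⁻¹ ^ k) ^ K * (2 * h * R) ^ m
          ≤ 2 ^ max k' K * 4 ^ k' * schwartzNorm (max k' K) F / (1 + ‖gridCentre n h c‖) ^ k' *
            (1 + (2 : ℝ)⁻¹ ^ k * R) ^ N₁ * ((2 : ℝ)⁻¹ ^ k) ^ K * max 1 (2 * h * R) ^ N₁ := by
            refine mul_le_mul (mul_le_mul_of_nonneg_right (mul_le_mul_of_nonneg_left hpow1 hP0) (by positivity))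
              hpow2 (by positivity) (by positivity)
        _ = B / (1 + ‖gridCentre n h c‖) ^ k' := by rw [hB]; ring
    · -- dead cube: the piece vanishes identically
      have hzero : (fun w => G w * ((pairCut n (k + 1) w - pairCut n k w) * gridBump φ n h c w)) = fun _ => (0 : ℝ) := by
        funext w
        have : (pairCut n (k + 1) w - pairCut n k w) * gridBump φ n h c w = 0 := by
          by_contra hne; exact hal ⟨w, hne⟩
        rw [this, mul_zero]
      rw [hzero, iteratedFDeriv_fun_zero, Pi.zero_apply, norm_zero]
      exact div_nonneg (hM0 c) (by positivity)

end Summit.QuantumFields.YangMills.Cruxes.AtomicCalibrationR.LevelMass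

end
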